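/-
Copyright (c) 2026 the pub-hodgecm-mathlib formalisation cell (harness21).  Prover seat hodgecm-mathlib-LH4-p12 (g7), req620 Track A «(D-RAM) FOUR-FRAME» squad
(heir LEAD F0P3a-plan (g20) T19-24 «STAGE-1b pre-scoping by idle hands: allowed as scoping»; dealer LH4-plan (g12) board STATUS #18); helper lane
`--supports stmt-HodgeConjecture-24833`.  2026-09-04.
-/
import Summits.HodgeConjecture.HodgeConjecture.Theorems.F0P3cDyRamFrameEltLevelAlgebra     -- ★ p858722 (this seat): `latticeInLevel_frameElt_iff_mem_defectSet`, `latticeInLevel_sq_frameElt_iff_mem_defectSet`, `frameElt_sub_one`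
import Literature.NumberTheory.Automorphic.UnitaryThreeFourFrameFixedVertexCriterion        -- ★ `mem_span_rankTwoShape_iff`, `mapGL_latt_eq_iff_of_defectSet_eq`; brings ★ A-1 `exists_defectSet_latt_eq_span`, ★ A-0 `moduleCriterion_holds`
import HarnessLib

/-!
# Crux `H413`, line LH4 «(D-RAM) FOUR-FRAME» road — THE COUNTING-READY IN-LEVEL AND SQUARE-LEVEL VERTEX CRITERIA, in the SAME vertex invariants `(c₁, c₂, k, u)` as the
# fixed-vertex criterion ★ `UnitaryThreeFourFrameFixedVertexCriterion`: every threshold raised by the level `m`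

Cell `hodgecm-mathlib` (D-0151), FLOOR 0, crux item H413 = `stmt-HodgeConjecture-24833`, route of record `HCCMUnconditional`; squad F0∕P3c∕LH4 (req618∕req620).
THEOREMS ONLY (no `def`, no instance, no notation, no `sorry`, default heartbeats); lane `--supports stmt-HodgeConjecture-24833 --as helper` (count-neutral).  A STAGE-1b
PRE-BRICK (T19-24 clause): the typed form of the «lever» of the PRESCOPE note `F0/P3c/LH4/LH4-p12/g7/PRESCOPE-stub_rows_regular.v1.LH4p12g7.md` §5 — the profile censuses
of the three open tier-0 rows (`regFixCount`, `transv{Plus,Minus}FixCount`, ★ U2G census DEFS) read the tokens `LatticeInLevel ϖ ℓ (T − 1) M` and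
`LatticeInLevel ϖ m ((T − 1)·(T − 1)) M` at a type-0 vertex `M`; at the frame literal `T = Γ_b = frameElt σ f b α β` these tokens are DECIDED BY THE SAME VERTEX DATA
`(c₁, c₂, k, u)` of `M = latt g` (★ A-1 `DefectModuleShape`: `M_Λ^{(b)} = 𝒪(ϖ^{c₁},0) + 𝒪(0,ϖ^{c₂}) + 𝒪(ϖ^{c₁−k}u, ϖ^{c₂−k})`) that decide `Γ_bΛ = Λ`
(★ `mapGL_latt_eq_iff_of_defectSet_eq`), with every threshold RAISED BY THE LEVEL:

* §1 `v_inv_pow_mul_le_iff` — the valuation bookkeeping `|ϖ^{−m}x| ≤ |ϖ^a| ⟺ |x| ≤ |ϖ^{a+m}|`.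
* §2 **`latticeInLevel_frameElt_latt_iff_of_defectSet_eq`** — for ANY `α, β` (no unitarity) and any `m`:
  `(Γ_b − 1)Λ ⊆ ϖ^mΛ ⟺ |α−1| ≤ |ϖ^{c₁−k+m}| ∧ |β−1| ≤ |ϖ^{c₂−k+m}| ∧ |(α−1)ϖ^{c₂−k} − (β−1)uϖ^{c₁−k}| ≤ |ϖ^{c₁+c₂−k+m}|`
  (★ p858722 `latticeInLevel_frameElt_iff_mem_defectSet` ∘ ★ `mem_span_rankTwoShape_iff` at the pair `(ϖ^{−m}(α−1), ϖ^{−m}(β−1))`); the GL-literal reading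
  `latticeInLevel_coe_sub_one_latt_iff_of_defectSet_eq`; and **`latticeInLevel_sq_frameElt_latt_iff_of_defectSet_eq`** — the SQUARE-LEVEL token, the same three inequalities at
  `((α−1)², (β−1)²)` (root depths doubled), with its GL-literal reading.
* §3 **`mapGL_latt_eq_of_latticeInLevel_frameElt`** — for `α, β ∈ E¹` an in-level vertex (any `m`) is a FIXED vertex (★ A-0), so the in-level census is a census INSIDE the fixed
  set: `{M type-0 | Γ_b M = M ∧ (Γ_b−1)M ⊆ ϖ^m M} = {M type-0 | (Γ_b−1)M ⊆ ϖ^m M}` (`setOf_fixed_and_latticeInLevel_eq`).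
* §4 **`exists_invariants_levels_latt_iff`** — the packaged form: for every lattice `latt g` and frame `b` ONE tuple `(c₁, c₂, k, u)` (the A-1 invariants, `c_i` the least axis
  exponents) decides, for EVERY `(α, β)` and EVERY level `m`, the in-level token AND the square-level token in closed form (next to ★ `exists_invariants_mapGL_latt_eq_iff`,
  which decides fixedness from the same tuple).

So a STAGE-1b profile census (regular piece: `fixedVertexCount − #{square-level}`, ★ p858722 `ncard_sqLevel_add_regFixCount_eq_fixedVertexCount`; shell pieces: two in-level
tokens and one square-level token, ★ census DEFS `LatticeNearTransvShell`) is a count of type-0 vertices by the ★ strata `(c₁, c₂, k, u)` against SHIFTED thresholds — the same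
enumeration as the fixed-vertex census of units U2G∕U3, no new vertex invariant.  (The passage from the dictionary literal `z·Γ_b` to `Γ_b` — central rescaling of the level ∕
square ∕ label tokens for `|z − 1| ≤ |ϖ|^m` — is LH4-p11 (g7)'s brick (c2) and is not restated here.)

HONEST LABEL.  Count-neutral helper: pays no stub; the three tier-0 rows stay OPEN; `HC_CM` is proved only modulo the 7 printed citations (2 remaining named inputs: hLiu418 =
`stmt-HodgeConjecture-24832`, h413 = `stmt-HodgeConjecture-24833`) until rung 0 closes.

## References
* [Kottwitz1986BaseChangeUnits] R. E. Kottwitz, *Base change for unit elements of Hecke algebras*, Compositio Math. 60 (1986), §1 pp. 240–241 (orbital integrals of units as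
  fixed-lattice counts of a torus element).
* [Rogawski1990] J. D. Rogawski, *Automorphic Representations of Unitary Groups in Three Variables*, Ann. of Math. Stud. 123 (1990), §4.9 Prop. 4.9.1 p. 55.
* [Lang2002] S. Lang, *Algebra*, rev. 3rd ed., GTM 211 (2002), Ch. III §7 Thm. 7.8 (stacked bases over a principal ring).
* [Serre1979] J.-P. Serre, *Local Fields*, GTM 67 (1979), Ch. I §1 (divisibility in a discrete valuation ring = comparison of valuations).
-/

set_option autoImplicit false

noncomputable section

namespace Summit.HodgeConjecture.HodgeConjecture.Cruxes.H413.F0P3cDyRamLevelVertexCriterion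

open Literature.NumberTheory.Automorphic Literature.NumberTheory.Automorphic.UnitaryLatticeTree Literature.NumberTheory.Automorphic.HermitianLattice
open Literature.NumberTheory.Automorphic.UnitaryThreeFourFrame Literature.NumberTheory.Automorphic.CartanUnique
open Summit.HodgeConjecture.HodgeConjecture.Cruxes.H413.F0P3cDyRamFourFrameCensusDefs
open Summit.HodgeConjecture.HodgeConjecture.Cruxes.H413.F0P3cDyRamFrameEltLevelAlgebra
open scoped Matrix MatrixGroups Valued WithZero

variable {K : Type} [Field K] [Valued K ℤᵐ⁰]

/-! ## §1  Valuation bookkeeping -/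

/-- `|ϖ^{−m}·x| ≤ |ϖ^a| ⟺ |x| ≤ |ϖ^{a+m}|` (`ϖ ≠ 0`). [cite: Serre1979, Ch. I §1] -/
theorem v_inv_pow_mul_le_iff {ϖ : K} (hϖ0 : ϖ ≠ 0) (x : K) (a m : ℕ) :
    Valued.v ((ϖ ^ m)⁻¹ * x) ≤ Valued.v (ϖ ^ a) ↔ Valued.v x ≤ Valued.v (ϖ ^ (a + m)) := by
  have hpm : (ϖ ^ m : K) ≠ 0 := pow_ne_zero m hϖ0
  have hvpm : 0 < Valued.v (ϖ ^ m : K) := (Valuation.pos_iff _).2 hpm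
  rw [map_mul, map_inv₀, inv_mul_le_iff₀ hvpm, ← map_mul, ← pow_add, add_comm]

/-! ## §2  The in-level and square-level tokens of the frame element in closed form -/

section ClosedForm

variable (σ : K →+* K) (f : Fin 4 → Fin 3 → (Fin 3 → K)) (b : Fin 4)

/-- **`(Γ_b − 1)·Λ ⊆ ϖ^m·Λ` IN CLOSED FORM.**  For `Γ_b = frameElt σ f b α β` with ANY parameters `α, β` (no unitarity), a level `m`, and a lattice `Λ = latt g` whose defect set in
frame `b` is `𝒪(ϖ^{c₁},0) + 𝒪(0,ϖ^{c₂}) + 𝒪(ϖ^{c₁−k}u, ϖ^{c₂−k})` (`k ≤ c₁, c₂`, `u` a unit — ★ A-1's output):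
`(Γ_b − 1)Λ ⊆ ϖ^mΛ ⟺ |α−1| ≤ |ϖ^{c₁−k+m}| ∧ |β−1| ≤ |ϖ^{c₂−k+m}| ∧ |(α−1)ϖ^{c₂−k} − (β−1)uϖ^{c₁−k}| ≤ |ϖ^{c₁+c₂−k+m}|` — ★ `mapGL_latt_eq_iff_of_defectSet_eq`'s test with every
threshold raised by `m` (`m = 0`: the defect-set membership of `(α−1, β−1)` itself). [cite: Kottwitz1986BaseChangeUnits, §1 pp. 240–241] [cite: Lang2002, Ch. III §7 Thm. 7.8] -/
theorem latticeInLevel_frameElt_latt_iff_of_defectSet_eq (α β : K) {ϖ : K} (hϖ : Valued.v ϖ = WithZero.exp (-1 : ℤ)) (g : GL (Fin 3) K)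
    {c₁ c₂ k : ℕ} (hk₁ : k ≤ c₁) (hk₂ : k ≤ c₂) {u : K} (hu : Valued.v u = 1)
    (hM : defectSet (frameProj σ (f b 0)) (frameProj σ (f b 1)) (latt (g : Matrix (Fin 3) (Fin 3) K)) =
      (Submodule.span 𝒪[K] ({((ϖ ^ c₁ : K), (0 : K)), ((0 : K), (ϖ ^ c₂ : K)), (ϖ ^ (c₁ - k) * u, ϖ ^ (c₂ - k))} : Set (K × K)) : Set (K × K)))
    (m : ℕ) :
    LatticeInLevel ϖ m (frameElt σ f b α β - 1) (latt (g : Matrix (Fin 3) (Fin 3) K)) ↔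
      Valued.v (α - 1) ≤ Valued.v (ϖ ^ (c₁ - k + m)) ∧ Valued.v (β - 1) ≤ Valued.v (ϖ ^ (c₂ - k + m)) ∧
        Valued.v ((α - 1) * ϖ ^ (c₂ - k) - (β - 1) * u * ϖ ^ (c₁ - k)) ≤ Valued.v (ϖ ^ (c₁ + c₂ - k + m)) := by
  have hϖ0 : ϖ ≠ 0 := uniformizer_ne_zero hϖ
  have e3 : (ϖ ^ m)⁻¹ * (α - 1) * ϖ ^ (c₂ - k) - (ϖ ^ m)⁻¹ * (β - 1) * u * ϖ ^ (c₁ - k) =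
      (ϖ ^ m)⁻¹ * ((α - 1) * ϖ ^ (c₂ - k) - (β - 1) * u * ϖ ^ (c₁ - k)) := by ring
  rw [latticeInLevel_frameElt_iff_mem_defectSet σ f b α β hϖ0 m, hM, SetLike.mem_coe, mem_span_rankTwoShape_iff hϖ hk₁ hk₂ hu, e3,
    v_inv_pow_mul_le_iff hϖ0, v_inv_pow_mul_le_iff hϖ0, v_inv_pow_mul_le_iff hϖ0]

/-- The same at a `GL₃` LITERAL `T` with `(T : M₃) = Γ_b` (the shape in which the census DEFS and the law Props bind the frame element). [cite: Kottwitz1986BaseChangeUnits, §1 pp. 240–241] -/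
theorem latticeInLevel_coe_sub_one_latt_iff_of_defectSet_eq (α β : K) {T : GL (Fin 3) K} (hT : (T : Matrix (Fin 3) (Fin 3) K) = frameElt σ f b α β)
    {ϖ : K} (hϖ : Valued.v ϖ = WithZero.exp (-1 : ℤ)) (g : GL (Fin 3) K)
    {c₁ c₂ k : ℕ} (hk₁ : k ≤ c₁) (hk₂ : k ≤ c₂) {u : K} (hu : Valued.v u = 1)
    (hM : defectSet (frameProj σ (f b 0)) (frameProj σ (f b 1)) (latt (g : Matrix (Fin 3) (Fin 3) K)) =
      (Submodule.span 𝒪[K] ({((ϖ ^ c₁ : K), (0 : K)), ((0 : K), (ϖ ^ c₂ : K)), (ϖ ^ (c₁ - k) * u, ϖ ^ (c₂ - k))} : Set (K × K)) : Set (K × K)))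
    (m : ℕ) :
    LatticeInLevel ϖ m ((T : Matrix (Fin 3) (Fin 3) K) - 1) (latt (g : Matrix (Fin 3) (Fin 3) K)) ↔
      Valued.v (α - 1) ≤ Valued.v (ϖ ^ (c₁ - k + m)) ∧ Valued.v (β - 1) ≤ Valued.v (ϖ ^ (c₂ - k + m)) ∧
        Valued.v ((α - 1) * ϖ ^ (c₂ - k) - (β - 1) * u * ϖ ^ (c₁ - k)) ≤ Valued.v (ϖ ^ (c₁ + c₂ - k + m)) := by
  rw [hT]
  exact latticeInLevel_frameElt_latt_iff_of_defectSet_eq σ f b α β hϖ g hk₁ hk₂ hu hM m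

variable {σ f}

/-- **`(Γ_b − 1)²·Λ ⊆ ϖ^m·Λ` IN CLOSED FORM** (the SQUARE-LEVEL token the profile pieces read): for a four-frame family, ANY `α, β`, any `m`, and `Λ = latt g` with A-1 data
`(c₁, c₂, k, u)`: `(Γ_b − 1)²Λ ⊆ ϖ^mΛ ⟺ |(α−1)²| ≤ |ϖ^{c₁−k+m}| ∧ |(β−1)²| ≤ |ϖ^{c₂−k+m}| ∧ |(α−1)²ϖ^{c₂−k} − (β−1)²uϖ^{c₁−k}| ≤ |ϖ^{c₁+c₂−k+m}|` — the in-level test at the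
SQUARED axis parameters (★ p858722 `frameElt_sub_one_mul_self`: the root depths `n₂ = v(α−1)`, `n₁ = v(β−1)` doubled). [cite: Kottwitz1986BaseChangeUnits, §1 pp. 240–241] [cite: Rogawski1990, §4.9 Prop. 4.9.1 p. 55] -/
theorem latticeInLevel_sq_frameElt_latt_iff_of_defectSet_eq (hf : IsFourFrameFamily σ f) (b : Fin 4) (α β : K) {ϖ : K} (hϖ : Valued.v ϖ = WithZero.exp (-1 : ℤ))
    (g : GL (Fin 3) K) {c₁ c₂ k : ℕ} (hk₁ : k ≤ c₁) (hk₂ : k ≤ c₂) {u : K} (hu : Valued.v u = 1)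
    (hM : defectSet (frameProj σ (f b 0)) (frameProj σ (f b 1)) (latt (g : Matrix (Fin 3) (Fin 3) K)) =
      (Submodule.span 𝒪[K] ({((ϖ ^ c₁ : K), (0 : K)), ((0 : K), (ϖ ^ c₂ : K)), (ϖ ^ (c₁ - k) * u, ϖ ^ (c₂ - k))} : Set (K × K)) : Set (K × K)))
    (m : ℕ) :
    LatticeInLevel ϖ m ((frameElt σ f b α β - 1) * (frameElt σ f b α β - 1)) (latt (g : Matrix (Fin 3) (Fin 3) K)) ↔
      Valued.v ((α - 1) ^ 2) ≤ Valued.v (ϖ ^ (c₁ - k + m)) ∧ Valued.v ((β - 1) ^ 2) ≤ Valued.v (ϖ ^ (c₂ - k + m)) ∧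
        Valued.v ((α - 1) ^ 2 * ϖ ^ (c₂ - k) - (β - 1) ^ 2 * u * ϖ ^ (c₁ - k)) ≤ Valued.v (ϖ ^ (c₁ + c₂ - k + m)) := by
  have hϖ0 : ϖ ≠ 0 := uniformizer_ne_zero hϖ
  have e3 : (ϖ ^ m)⁻¹ * (α - 1) ^ 2 * ϖ ^ (c₂ - k) - (ϖ ^ m)⁻¹ * (β - 1) ^ 2 * u * ϖ ^ (c₁ - k) =
      (ϖ ^ m)⁻¹ * ((α - 1) ^ 2 * ϖ ^ (c₂ - k) - (β - 1) ^ 2 * u * ϖ ^ (c₁ - k)) := by ring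
  rw [latticeInLevel_sq_frameElt_iff_mem_defectSet hf b α β hϖ0 m, hM, SetLike.mem_coe, mem_span_rankTwoShape_iff hϖ hk₁ hk₂ hu, e3,
    v_inv_pow_mul_le_iff hϖ0, v_inv_pow_mul_le_iff hϖ0, v_inv_pow_mul_le_iff hϖ0]

/-- The square-level token at a `GL₃` LITERAL `T` with `(T : M₃) = Γ_b` (the shape `((T : M₃) − 1)·((T : M₃) − 1)` of ★ `regFixCount` ∕ `LatticeNearTransvShell`).
[cite: Kottwitz1986BaseChangeUnits, §1 pp. 240–241] -/
theorem latticeInLevel_sq_coe_sub_one_latt_iff_of_defectSet_eq (hf : IsFourFrameFamily σ f) (b : Fin 4) (α β : K) {T : GL (Fin 3) K}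
    (hT : (T : Matrix (Fin 3) (Fin 3) K) = frameElt σ f b α β) {ϖ : K} (hϖ : Valued.v ϖ = WithZero.exp (-1 : ℤ))
    (g : GL (Fin 3) K) {c₁ c₂ k : ℕ} (hk₁ : k ≤ c₁) (hk₂ : k ≤ c₂) {u : K} (hu : Valued.v u = 1)
    (hM : defectSet (frameProj σ (f b 0)) (frameProj σ (f b 1)) (latt (g : Matrix (Fin 3) (Fin 3) K)) =
      (Submodule.span 𝒪[K] ({((ϖ ^ c₁ : K), (0 : K)), ((0 : K), (ϖ ^ c₂ : K)), (ϖ ^ (c₁ - k) * u, ϖ ^ (c₂ - k))} : Set (K × K)) : Set (K × K)))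
    (m : ℕ) :
    LatticeInLevel ϖ m (((T : Matrix (Fin 3) (Fin 3) K) - 1) * ((T : Matrix (Fin 3) (Fin 3) K) - 1)) (latt (g : Matrix (Fin 3) (Fin 3) K)) ↔
      Valued.v ((α - 1) ^ 2) ≤ Valued.v (ϖ ^ (c₁ - k + m)) ∧ Valued.v ((β - 1) ^ 2) ≤ Valued.v (ϖ ^ (c₂ - k + m)) ∧
        Valued.v ((α - 1) ^ 2 * ϖ ^ (c₂ - k) - (β - 1) ^ 2 * u * ϖ ^ (c₁ - k)) ≤ Valued.v (ϖ ^ (c₁ + c₂ - k + m)) := by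
  rw [hT]
  exact latticeInLevel_sq_frameElt_latt_iff_of_defectSet_eq hf b α β hϖ g hk₁ hk₂ hu hM m

end ClosedForm

/-! ## §3  An in-level vertex is a fixed vertex -/

section Fixed

variable {σ : K →+* K} {f : Fin 4 → Fin 3 → (Fin 3 → K)}

/-- `(Γ_b − 1)·Λ ⊆ ϖ^m·Λ ⟹ (α−1, β−1) ∈ M_Λ` (`|ϖ| ≤ 1`: `ϖ^mΛ ⊆ Λ`), for any lattice `Λ` and any `α, β`. [cite: Kottwitz1986BaseChangeUnits, §1 pp. 240–241] -/
theorem mem_defectSet_of_latticeInLevel_frameElt (σ : K →+* K) (f : Fin 4 → Fin 3 → (Fin 3 → K)) (b : Fin 4) (α β : K) {ϖ : K} (hϖ1 : Valued.v ϖ ≤ 1) (m : ℕ)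
    (Λ : Submodule 𝒪[K] (Fin 3 → K)) (h : LatticeInLevel ϖ m (frameElt σ f b α β - 1) Λ) :
    (α - 1, β - 1) ∈ defectSet (frameProj σ (f b 0)) (frameProj σ (f b 1)) Λ := by
  have hle : Λ.map ((Matrix.toLin' (frameElt σ f b α β - 1)).restrictScalars 𝒪[K]) ≤ Λ :=
    (show Λ.map ((Matrix.toLin' (frameElt σ f b α β - 1)).restrictScalars 𝒪[K]) ≤ scaleLattice (ϖ ^ m) Λ from h).trans
      (scaleLattice_le_self_of_v_le_one (by rw [map_pow]; exact pow_le_one₀ zero_le hϖ1) Λ)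
  rw [frameElt_sub_one] at hle
  exact hle

/-- **AN IN-LEVEL VERTEX IS A FIXED VERTEX**: for `α, β ∈ E¹` (`σ` an isometric involution), `Γ = γ_b` and any `m`: `(Γ_b − 1)·(latt g) ⊆ ϖ^m·(latt g) ⟹ Γ·(latt g) = latt g`
(★ A-0 `moduleCriterion_holds`). [cite: Kottwitz1986BaseChangeUnits, §1 pp. 240–241] [cite: Rogawski1990, §4.9 Prop. 4.9.1 p. 55] -/
theorem mapGL_latt_eq_of_latticeInLevel_frameElt (σ : K →+* K) (hσ : ∀ x, σ (σ x) = x) (hvσ : ∀ a, Valued.v (σ a) = Valued.v a)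
    (f : Fin 4 → Fin 3 → (Fin 3 → K)) (hf : IsFourFrameFamily σ f) {α β : K} (hα : α * σ α = 1) (hβ : β * σ β = 1)
    (b : Fin 4) (Γ : GL (Fin 3) K) (hΓ : (Γ : Matrix (Fin 3) (Fin 3) K) = frameElt σ f b α β) (g : GL (Fin 3) K)
    {ϖ : K} (hϖ1 : Valued.v ϖ ≤ 1) (m : ℕ) (h : LatticeInLevel ϖ m (frameElt σ f b α β - 1) (latt (g : Matrix (Fin 3) (Fin 3) K))) :
    mapGL Γ (latt (g : Matrix (Fin 3) (Fin 3) K)) = latt (g : Matrix (Fin 3) (Fin 3) K) :=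
  (moduleCriterion_holds σ hσ hvσ f hf α β hα hβ b Γ hΓ g).2 (mem_defectSet_of_latticeInLevel_frameElt σ f b α β hϖ1 m _ h)

/-- **THE IN-LEVEL CENSUS LIVES INSIDE THE FIXED SET**: for `α, β ∈ E¹` and the literal `Γ = γ_b`, the type-`t` vertices with `(Γ−1)M ⊆ ϖ^m M` are fixed by `Γ`, so
`{M type-t | ΓM = M ∧ (Γ−1)M ⊆ ϖ^m M} = {M type-t | (Γ−1)M ⊆ ϖ^m M}`. [cite: Kottwitz1986BaseChangeUnits, §1 pp. 240–241] -/
theorem setOf_fixed_and_latticeInLevel_eq (σ : K →+* K) (hσ : ∀ x, σ (σ x) = x) (hvσ : ∀ a, Valued.v (σ a) = Valued.v a)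
    (f : Fin 4 → Fin 3 → (Fin 3 → K)) (hf : IsFourFrameFamily σ f) {α β : K} (hα : α * σ α = 1) (hβ : β * σ β = 1)
    (b : Fin 4) (Γ : GL (Fin 3) K) (hΓ : (Γ : Matrix (Fin 3) (Fin 3) K) = frameElt σ f b α β)
    {ϖ : K} (hϖ1 : Valued.v ϖ ≤ 1) (H : Matrix (Fin 3) (Fin 3) K) (t m : ℕ) :
    {M : Submodule 𝒪[K] (Fin 3 → K) | IsVertexLattice σ ϖ H t M ∧ mapGL Γ M = M ∧ LatticeInLevel ϖ m ((Γ : Matrix (Fin 3) (Fin 3) K) - 1) M} =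
      {M : Submodule 𝒪[K] (Fin 3 → K) | IsVertexLattice σ ϖ H t M ∧ LatticeInLevel ϖ m ((Γ : Matrix (Fin 3) (Fin 3) K) - 1) M} := by
  ext M
  simp only [Set.mem_setOf_eq]
  constructor
  · rintro ⟨hV, -, hL⟩
    exact ⟨hV, hL⟩
  · rintro ⟨hV, hL⟩
    refine ⟨hV, ?_, hL⟩
    obtain ⟨g, hMg, -⟩ := hV
    subst hMg
    rw [hΓ] at hL
    exact mapGL_latt_eq_of_latticeInLevel_frameElt σ hσ hvσ f hf hα hβ b Γ hΓ g hϖ1 m hL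

end Fixed

/-! ## §4  The packaged form: one tuple of vertex invariants decides every level of every frame element -/

section Packaged

variable {σ : K →+* K} {f : Fin 4 → Fin 3 → (Fin 3 → K)}

/-- **THE VERTEX INVARIANTS DECIDE EVERY LEVEL OF EVERY `γ_b` AT ONCE.**  For a four-frame family `f` at `Φ₃`, a uniformiser `ϖ`, every frame `b` and every lattice `Λ = latt g`
there are invariants `(c₁, c₂, k, u)` — `c_i` the LEAST `c` with `ϖ^c π_i^{(b)} Λ ⊆ Λ`, `k ≤ min(c₁, c₂)`, `u` a unit (★ A-1) — such that for ALL `α, β` and ALL `m`: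
`(Γ_b − 1)Λ ⊆ ϖ^mΛ ⟺ |α−1| ≤ |ϖ^{c₁−k+m}| ∧ |β−1| ≤ |ϖ^{c₂−k+m}| ∧ |(α−1)ϖ^{c₂−k} − (β−1)uϖ^{c₁−k}| ≤ |ϖ^{c₁+c₂−k+m}|` and
`(Γ_b − 1)²Λ ⊆ ϖ^mΛ ⟺` the same at `((α−1)², (β−1)²)`.  Companion of ★ `exists_invariants_mapGL_latt_eq_iff` (fixedness from the same tuple); together they make every
level ∕ square-level ∕ fixed census of the frame literals a count of vertices by `(c₁, c₂, k, u)` against thresholds shifted by the level.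
[cite: Kottwitz1986BaseChangeUnits, §1 pp. 240–241] [cite: Lang2002, Ch. III §7 Thm. 7.8] [cite: Rogawski1990, §4.9 Prop. 4.9.1 p. 55] -/
theorem exists_invariants_levels_latt_iff (hf : IsFourFrameFamily σ f) {ϖ : K} (hϖ : Valued.v ϖ = WithZero.exp (-1 : ℤ)) (b : Fin 4) (g : GL (Fin 3) K) :
    ∃ (c₁ c₂ k : ℕ) (u : K), Valued.v u = 1 ∧ k ≤ c₁ ∧ k ≤ c₂ ∧
      IsLeast {c : ℕ | AxisStable ϖ (frameProj σ (f b 0)) (latt (g : Matrix (Fin 3) (Fin 3) K)) c} c₁ ∧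
      IsLeast {c : ℕ | AxisStable ϖ (frameProj σ (f b 1)) (latt (g : Matrix (Fin 3) (Fin 3) K)) c} c₂ ∧
      ∀ (α β : K) (m : ℕ),
        (LatticeInLevel ϖ m (frameElt σ f b α β - 1) (latt (g : Matrix (Fin 3) (Fin 3) K)) ↔
          Valued.v (α - 1) ≤ Valued.v (ϖ ^ (c₁ - k + m)) ∧ Valued.v (β - 1) ≤ Valued.v (ϖ ^ (c₂ - k + m)) ∧
            Valued.v ((α - 1) * ϖ ^ (c₂ - k) - (β - 1) * u * ϖ ^ (c₁ - k)) ≤ Valued.v (ϖ ^ (c₁ + c₂ - k + m))) ∧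
        (LatticeInLevel ϖ m ((frameElt σ f b α β - 1) * (frameElt σ f b α β - 1)) (latt (g : Matrix (Fin 3) (Fin 3) K)) ↔
          Valued.v ((α - 1) ^ 2) ≤ Valued.v (ϖ ^ (c₁ - k + m)) ∧ Valued.v ((β - 1) ^ 2) ≤ Valued.v (ϖ ^ (c₂ - k + m)) ∧
            Valued.v ((α - 1) ^ 2 * ϖ ^ (c₂ - k) - (β - 1) ^ 2 * u * ϖ ^ (c₁ - k)) ≤ Valued.v (ϖ ^ (c₁ + c₂ - k + m))) := by
  obtain ⟨horth, hnz, -, -, -⟩ := hf b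
  obtain ⟨c₁, c₂, k, u, hu, hk₁, hk₂, hc₁, hc₂, hEq⟩ :=
    exists_defectSet_latt_eq_span hϖ (frameProj_mul_self σ (hnz 0)) (frameProj_mul_self σ (hnz 1))
      (frameProj_mul_frameProj_of_pairing_eq_zero σ (horth 0 1 (by decide)))
      (frameProj_mul_frameProj_of_pairing_eq_zero σ (horth 1 0 (by decide)))
      (frameProj_ne_zero σ (hnz 0)) (frameProj_ne_zero σ (hnz 1)) g
  exact ⟨c₁, c₂, k, u, hu, hk₁, hk₂, hc₁, hc₂, fun α β m =>
    ⟨latticeInLevel_frameElt_latt_iff_of_defectSet_eq σ f b α β hϖ g hk₁ hk₂ hu hEq m,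
      latticeInLevel_sq_frameElt_latt_iff_of_defectSet_eq hf b α β hϖ g hk₁ hk₂ hu hEq m⟩⟩

end Packaged

end Summit.HodgeConjecture.HodgeConjecture.Cruxes.H413.F0P3cDyRamLevelVertexCriterion

end
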